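import Summits.BirchSwinnertonDyer.BirchSwinnertonDyer.Theorems.CMKolyvaginAtInertTwoCebotarevLeafAtTwoPow
import Summits.BirchSwinnertonDyer.BirchSwinnertonDyer.Theorems.CMKolyvaginAtInertTwoReciprocityLeafAtTwoPow
import Summits.BirchSwinnertonDyer.BirchSwinnertonDyer.Theorems.CMKolyvaginAtInertTwoTauPartDescentAtTwo
import Summits.BirchSwinnertonDyer.BirchSwinnertonDyer.Theorems.CMKolyvaginAtInertTwoBottomBitsAtTwo
import HarnessLib

/-!
# Route `CMKolyvaginAtInertTwo`, crux `CMKolyvaginExactAtInertTwo` (stmt-BirchSwinnertonDyer-24277):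
# THE `(−ε)`-PART DESCENT AT `p = 2`, LEVEL `2^M` — `2^a ∤ y_K`-type non-divisibility + the
# machine's two inputs at `(2, M)` ⟹ `2^{M−a}` KILLS `Sel_{2^M}(E/K)^{−ε}` (Gross's Prop. 2.1 /
# the rank-zero-twin half of Kolyvagin's descent at `2`, ONE bit weaker than at odd `p`)

Seat `bsd-line-cmk2-p1` g7 (cell `bsd-print-cf2`); helper (`--supports stmt-BirchSwinnertonDyer-24277`).
THEOREMS ONLY: no definition, no named fact, no `sorry`; no item is closed; BSD is not proved by this.

WHAT. The memo (`Cruxes/CMExactDescentAtTwo/MEMO-tau-line-at-two.md` §1) shows that at `p = 2`,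
level `2`, the local pairing at a Kolyvagin prime is VOID: both `τ`-eigenlines of `E[2]` collapse
to the fixed line `{0, T_ℝ}`. At level `2^M`, `M ≥ 2`, the two eigenlines `E[2^M]^{τ = ±1}` are
DISTINCT cyclic groups of order `2^M` meeting in `{0, T_ℝ}` and pairing onto `2·μ_{2^M}` (one bit
lost, §4 of the memo). This file turns that into the first kernel statement at `2` separating the
two signs — the `p = 2` form of Gross 1991 Prop. 2.1 "`c(ℓ)` kills `Sel^{−ε}`" (the half of
Kolyvagin's descent that concerns the rank-ZERO twist `E^{(d_K)}`, since `y_K ∈ E(K)^{ε}`):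

* `two_pow_smul_selmer_minus_eq_zero_two_pow` — `E/ℚ` elliptic with `ρ̄_{E,2}` onto and `Δ_E < 0`,
  `K` imaginary quadratic with `Δ_E ∉ K²` and conjugation `c`, `P = y_K ∈ E(K)` a Heegner point of
  level `N`; `M ≥ 1`, `a < M`, and **`2^a y_K ∉ 2^M E(K)`** (for `E(K)[2] = 0`: `2^{M−a} ∤ y_K`, i.e.
  `a = M − 1 − M₀` with `2^{M₀} ∥ y_K`); a sign `ν = ±1` with `c y_K − ν y_K` NOT torsion (i.e.
  `ν = −ε`); the Cartan-type element `z` (`hcomm`, see `…RestrictionInjectiveAtTwoPow`); GIVEN the two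
  inputs of the kernel Kolyvagin machine at `(p, M) = (2, M)` in their binder shapes (`hpoints` —
  Gross (4.4), Props. 5.3, 6.2 — and the pairing-form reciprocity `hRT` — McCallum Prop. 2.2 + Lemma
  5.3 —, the level-`M` instances of the binders of `KolyvaginDescent.pow_smul_sha_primary_eq_zero_at_
  of_pointsM_of_reciprocityFinset`; HYPOTHESES at `2` / CM, typed as data by ty2, p601266):
  **`2^{M−a}·s = 0` for every `s ∈ Sel_{2^M}(E/K)` with `c_* s = ν s`.** With `a = M − 1 − M₀`:
  `2^{M₀+1}` kills `Sel_{2^M}(E/K)^{−ε}` for every `M` (odd `p`: `p^{M₀}`; the extra bit is the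
  index of `E[2^M]^+ ⊕ E[2^M]^−` in `E[2^M]`).
  PROOF (kernel form). Let `x = 2^a c(1) = δ(2^a y_K) ≠ 0` (`ε`-eigen) and suppose
  `w = 2^{M−a} s ≠ 0` (`ν`-eigen). Take the bottom bits `u₂ = 2^j w`, `x₂ = 2^i x` (order `2`,
  `i < M − a`); they are `c_*`-FIXED. The Čebotarev leaf at level `2^M` (this seat,
  `exists_kolyvaginPrime_gt_two_pow_of_targets`, family `(u₂, x₂)` or `(x₂)`, target a `τ`-moved
  `2`-torsion point `v₁`) gives a Kolyvagin prime `ℓ` of depth `M` with `u_{2,λ} ≠ 0`, `x_{2,λ} ≠ 0`.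
  Gross's Prop. 6.2 (2) (`hpoints`, exponent `i + a`): `2^{i+a} c(ℓ)` is NOT Selmer at `λ`.
  `d = c(ℓ)` is a `(−ε) = ν`-eigenclass, Selmer off `ℓ` and at `∞`; leaf (B) at `2^M` (g6,
  `lemma_5_3_descent_two_pow`, p612024) with exponent `i + a` gives
  `2^{M−i−a−1}(s + ν c_* s) = 2^{M−i−a−1}·2s ∈ ker loc_λ`, and `u₂ = 2^{j+i}·(that)` — contradiction.
* `two_pow_smul_selmer_minus_eq_zero_of_families_two_pow` — the same with ty2's DATA
  (`PointSystemFamily N W K P 2 ⊤`, `ReciprocityFamily N W K 2 ⊤`, p601266) at level `M`.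

HONEST FRAMING. (1) This is the `(−ε)`-part only: together with g6's `τ`-part descent it is all that
single Kolyvagin primes give at `2`; the `ε`-part needs the two-prime step (McCallum §5), and the
`τ`-invariant ORDER-`2` classes (`Sel₂(E/K)^τ`) remain invisible to every eigen Kolyvagin class at
every level, so the crux's exact ORDER of `Ш(E/K)[2^∞]` is NOT reached by this method. (2) On H₂
(`ε = +1`, analytic rank one) the `(−ε)`-part is the Selmer group of the CM rank-zero twist, whose
BSD₂ is print (Burungale–Flach 2024) — the value here is the KERNEL MECHANISM at `2`, not a new leaf.
(3) Hypotheses at `2` not in print: `hpoints`, `hRT` (data), `hcomm` (CM theory on `E[2^∞]`).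

References: [GrossLMS1991] Prop. 2.1 and §§8–10, (4.4), Props. 5.3, 6.2; [McCallumLMS1991] §2
Prop. 2.2, §3 Cor. 3.2, §5 Lemmas 5.1, 5.3; [Kolyvagin1989Izv] Thm. B (the `l = 2` level shift);
the memo and KERNEL-STATUS-p2-port.md (v5) of this crux.
-/

-- single-conjunct summit: `Summit.BirchSwinnertonDyer.BirchSwinnertonDyer.…` repeats the name by design
set_option linter.dupNamespace false
set_option autoImplicit false

noncomputable section

open scoped Classical
open WeierstrassCurve NumberField IsDedekindDomain Field
open Literature.NumberTheory.GaloisRepresentations Literature.NumberTheory.EllipticCurves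

namespace Summit.BirchSwinnertonDyer.BirchSwinnertonDyer.Theorems.KolyvaginDescentTwo

/-! ## The `(−ε)`-part descent at `p = 2`, level `2^M` -/

-- `K : Type` (universe 0) as in the Čebotarev leaves at `2` and the route items
variable (W : WeierstrassCurve ℚ) {K : Type} [Field K] [NumberField K]

-- one long assembly; aggregate budget only
set_option maxHeartbeats 800000 in
/-- **`2^{M−a}` kills `Sel_{2^M}(E/K)^{ν}`, `ν = −ε`, when `2^a y_K ∉ 2^M E(K)`, given the
Kolyvagin machine's two inputs at `(2, M)`** (statement, proof and honest framing in the module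
docstring). Hypotheses: `K` imaginary quadratic with conjugation `c ≠ 1`; `P ∈ E(K)` a Heegner point
of level `N`; `ρ̄_{E,2}` onto, `Δ_E < 0`, `Δ_E ∉ K²`; `M ≥ 1`, the level written `q` with `q = 2^M`
(to consume the machine's binders literally); `z` without non-zero fixed point on `E[2]` commuting on
`E[2^M]` with `Γ_{K(E[2])}` (`hcomm`); `a < M` with `2^M Q ≠ 2^a P` for all `Q ∈ E(K)`; a sign `ν`
with `c P − ν P` not torsion; `hpoints` / `hRT` = the binders of the kernel machine at `p = 2`, level
`M`, for this `c`. Conclusion: `2^{M−a} s = 0` for every `s ∈ Sel_{2^M}(E/K)` with `c_* s = ν s`.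
[cite: GrossLMS1991, Prop. 2.1 with §10 (proof), (4.4), Props. 5.3, 6.2]
[cite: McCallumLMS1991, §2 Prop. 2.2, §3 Cor. 3.2, §5 Lemmas 5.1, 5.3] -/
theorem two_pow_smul_selmer_minus_eq_zero_two_pow {N : ℕ} [NeZero N] [W.IsElliptic]
    (hK : IsImaginaryQuadratic K) {P : (W.baseChange K).toAffine.Point} (hP : IsHeegnerPoint N W K P)
    (hρ : W.HasSurjectiveModNGaloisRep 2) (hΔ : W.Δ < 0) (hΔK : ¬ IsSquare (W.baseChange K).Δ)
    {c : K ≃ₐ[ℚ] K} (hc : c ≠ 1) {M : ℕ} (hM : 1 ≤ M) {q : ℕ} (hq : q = 2 ^ M)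
    {z : absoluteGaloisGroup K}
    (hzfix : ∀ T : geomTorsion (W.baseChange K) ((2 : ℕ) : ℤ), z • T = T → T = 0)
    (hcomm : ∀ π ∈ torsionFixing (W.baseChange K) ((2 : ℕ) : ℤ),
      ∀ T : geomTorsion (W.baseChange K) (q : ℤ), π • z • T = z • π • T)
    {a : ℕ} (ha : a < M)
    (hy : ∀ Q : (W.baseChange K).toAffine.Point, (q : ℤ) • Q ≠ ((((2 : ℕ) : ℤ) ^ a)) • P)
    {ν : ℤ} (hν : ν = 1 ∨ ν = -1)
    (hPν : ¬ IsOfFinAddOrder (Affine.Point.map (W' := W) (c : K →ₐ[ℚ] K) P - ν • P))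
    (hpoints : ∀ (hdiv : ∀ Q : geomPoints (W.baseChange K), ∃ R, (q : ℤ) • R = Q),
      ∃ (ε : ℤ) (τ : AlgebraicClosure K ≃+* AlgebraicClosure K) (hτ : IsLiftOfAut c τ)
        (A : ℕ → AddSubgroup (geomPoints (W.baseChange K)))
        (hA : ∀ m, KolyvaginCocycle.IsAdmissible (Field.absoluteGaloisGroup K) (A m) (q : ℤ))
        (Pt : ℕ → geomPoints (W.baseChange K))
        (hPt : ∀ m, Pt m ∈ KolyvaginCocycle.invPoints (Field.absoluteGaloisGroup K) (A m) (q : ℤ)),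
        (ε = 1 ∨ ε = -1) ∧
        IsOfFinAddOrder (Affine.Point.map (W' := W) (c : K →ₐ[ℚ] K) P - ε • P) ∧
        (∀ m, ∀ a ∈ A m, hτ.pointsMap W a ∈ A m) ∧
        Pt 1 = toGeomPoints (W.baseChange K) P ∧
        (∀ m : ℕ, Squarefree m →
          (∀ q' ∈ m.primeFactors, IsKolyvaginPrime N W K 2 q' ∧ FrobEqFrobInfty W K q q') →
          (∃ B ∈ A m, hτ.pointsMap W (Pt m) =
            (ε * (-1) ^ m.primeFactors.card) • Pt m + (q : ℤ) • B) ∧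
          (∀ v : HeightOneSpectrum (𝓞 K), (m : 𝓞 K) ∉ v.asIdeal →
            kolyvaginClass (W.baseChange K) _ hdiv (hA m) (Pt m) (hPt m) ∈
              selmerLocalKer (W.baseChange K) (v.adicCompletion K) (q : ℤ)) ∧
          (∀ ℓ : ℕ, ℓ.Prime → ℓ ∣ m → ∀ v : HeightOneSpectrum (𝓞 K), (ℓ : 𝓞 K) ∈ v.asIdeal →
            ∀ a : ℕ, ((((2 : ℕ) : ℤ) ^ a) •
                kolyvaginClass (W.baseChange K) _ hdiv (hA m) (Pt m) (hPt m) ∈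
                selmerLocalKer (W.baseChange K) (v.adicCompletion K) (q : ℤ) ↔
              (((2 : ℕ) : ℤ) ^ a) • kolyvaginClass (W.baseChange K) _ hdiv (hA (m / ℓ)) (Pt (m / ℓ))
                  (hPt (m / ℓ)) ∈
                (W.baseChange K).torsionLocalKer (v.adicCompletion K) (q : ℤ)))))
    (hRT : ∀ {ℓ : ℕ} (hℓ : IsKolyvaginPrime N W K 2 ℓ), FrobEqFrobInfty W K q ℓ →
      ∃ (A : Type) (_ : AddCommGroup A)
        (e : geomTorsion (W.baseChange K) (q : ℤ) →+ geomTorsion (W.baseChange K) (q : ℤ) →+ A),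
        (∀ x, e x x = 0) ∧ (∀ x, (∀ y, e x y = 0) → x = 0) ∧
        ∀ (T : Finset (HeightOneSpectrum (𝓞 K))),
        ∀ s ∈ selmerGroup (W.baseChange K) (q : ℤ),
          (∀ v ∈ T, s ∈ (W.baseChange K).torsionLocalKer (v.adicCompletion K) (q : ℤ)) →
          ∀ c' : galH1Torsion (W.baseChange K) (q : ℤ),
          (∀ v : HeightOneSpectrum (𝓞 K), v ∉ T → (ℓ : 𝓞 K) ∉ v.asIdeal →
            c' ∈ selmerLocalKer (W.baseChange K) (v.adicCompletion K) (q : ℤ)) →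
          (∀ w : InfinitePlace K, c' ∈ selmerLocalKer (W.baseChange K) w.Completion (q : ℤ)) →
          ∀ 𝔔 ∈ hℓ.place.primesAbove, ∀ F : Field.absoluteGaloisGroup K,
            IsArithFrobAt (𝓞 K) F 𝔔 → F ∈ torsionFixing (W.baseChange K) (q : ℤ) →
            ∀ σ ∈ 𝔔.inertia (Field.absoluteGaloisGroup K),
            e (h1Eval (W.baseChange K) (q : ℤ) s F) (h1Eval (W.baseChange K) (q : ℤ) c' σ) = 0) :
    ∀ s ∈ selmerGroup (W.baseChange K) (q : ℤ), conjAct W c (q : ℤ) s = ν • s →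
      (((2 : ℕ) : ℤ) ^ (M - a)) • s = 0 := by
  subst hq
  classical
  haveI : Fact (Nat.Prime 2) := ⟨Nat.prime_two⟩
  haveI : Algebra.IsQuadraticExtension ℚ K := ⟨hK.1⟩
  haveI : IsTotallyComplex K := hK.2
  intro s hs hsν
  have hq0 : ((2 ^ M : ℕ) : ℤ) ≠ 0 := by exact_mod_cast pow_ne_zero M two_ne_zero
  -- ### the classes `c(m)` from the points (McCallum's cocycle), `c(1) = δ y_K`
  have hdiv : ∀ Q : geomPoints (W.baseChange K), ∃ R, ((2 ^ M : ℕ) : ℤ) • R = Q :=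
    (W.baseChange K).zsmul_geomPoints_surjective_holds hq0
  obtain ⟨ε, τ, hτ, A, hA, Pt, hPt, hε, h53, hAτ, hPt1, hrel⟩ := hpoints hdiv
  -- (`cl` kept OPAQUE: a transparent `set` lets the unifier unfold `kolyvaginClass` and time out)
  obtain ⟨cl, hcl⟩ : ∃ cl : ℕ → galH1Torsion (W.baseChange K) ((2 ^ M : ℕ) : ℤ),
      ∀ m, cl m = kolyvaginClass (W.baseChange K) _ hdiv (hA m) (Pt m) (hPt m) := ⟨_, fun _ ↦ rfl⟩
  have hP1 : toGeomPoints (W.baseChange K) P ∈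
      KolyvaginCocycle.invPoints (Field.absoluteGaloisGroup K) (A 1) ((2 ^ M : ℕ) : ℤ) := by
    rw [← hPt1]; exact hPt 1
  have hc1 : cl 1 = kummerMapTorsion (W.baseChange K) _ hdiv P := by
    rw [hcl 1, KolyvaginDescent.kolyvaginClass_congr_point (hA 1) (hP' := hP1) hPt1]
    exact kolyvaginClass_toGeomPoints (hA 1) P hP1
  -- ### the sign: `ν = -ε`
  have hνε : ν = -ε := by
    rcases hε with rfl | rfl <;> rcases hν with rfl | rfl
    · exact absurd h53 hPν
    · rfl
    · norm_num
    · exact absurd h53 hPν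
  have hνν : ν * ν = 1 := by rcases hν with rfl | rfl <;> norm_num
  -- ### every class is killed by `2^M`
  have hqkill : ∀ y : galH1Torsion (W.baseChange K) ((2 ^ M : ℕ) : ℤ), (((2 : ℕ) : ℤ) ^ M) • y = 0 :=
    fun y ↦ by
      rw [← Nat.cast_pow]
      exact zsmul_galH1Torsion_eq_zero (W.baseChange K) ((2 ^ M : ℕ) : ℤ) y
  -- sign-fixing on classes killed by `2`
  have hsignfix : ∀ {μ : ℤ}, (μ = 1 ∨ μ = -1) →
      ∀ y : galH1Torsion (W.baseChange K) ((2 ^ M : ℕ) : ℤ), ((2 : ℕ) : ℤ) • y = 0 → μ • y = y := by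
    intro μ hμ y hy2
    rcases hμ with rfl | rfl
    · rw [one_zsmul]
    · have h : (2 : ℤ) • y = 0 := by exact_mod_cast hy2
      rw [two_zsmul] at h
      rw [neg_one_zsmul]
      exact neg_eq_of_add_eq_zero_left h
  -- ### `x = 2^a c(1) = δ(2^a y_K) ≠ 0` and `c_* c(1) = ε c(1)`
  have hx0 : (((2 : ℕ) : ℤ) ^ a) • cl 1 ≠ 0 := by
    intro h0
    have hker : (((2 : ℕ) : ℤ) ^ a) • P ∈ (kummerMapTorsion (W.baseChange K) _ hdiv).ker := by
      rw [AddMonoidHom.mem_ker, map_zsmul, ← hc1, h0]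
    rw [kummerMapTorsion_ker, AddMonoidHom.mem_range] at hker
    obtain ⟨R, hR⟩ := hker
    exact hy R hR
  have hone : ∀ q' ∈ (1 : ℕ).primeFactors,
      IsKolyvaginPrime N W K 2 q' ∧ FrobEqFrobInfty W K (2 ^ M) q' :=
    fun q' hq' ↦ absurd hq' (by simp)
  have hx1 : conjAct W c _ (cl 1) = ε • cl 1 := by
    have h := conjAct_kolyvaginClass_eq_smul W (hdiv := hdiv) hτ (hA 1) (hAτ 1) (hPt 1) _
      (hrel 1 squarefree_one hone).1
    rw [← hcl 1, Nat.primeFactors_one, Finset.card_empty, pow_zero, mul_one] at h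
    exact h
  -- ### suppose `w = 2^{M-a} s ≠ 0`; bottom bits `u₂ = 2^j w`, `x₂ = 2^i x`
  by_contra hw
  obtain ⟨j, -, hu0, hu2⟩ :=
    exists_two_pow_zsmul_ne_zero_two_zsmul_eq_zero M (z := (((2 : ℕ) : ℤ) ^ (M - a)) • s)
      (hqkill _) hw
  obtain ⟨i, hi, hxi0, hxi2⟩ :=
    exists_two_pow_zsmul_ne_zero_two_zsmul_eq_zero (M - a) (z := (((2 : ℕ) : ℤ) ^ a) • cl 1)
      (by rw [smul_smul, ← pow_add, show M - a + a = M by omega, hqkill]) hx0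
  set u₂ : galH1Torsion (W.baseChange K) ((2 ^ M : ℕ) : ℤ) :=
    (((2 : ℕ) : ℤ) ^ j) • ((((2 : ℕ) : ℤ) ^ (M - a)) • s) with hu₂
  set x₂ : galH1Torsion (W.baseChange K) ((2 ^ M : ℕ) : ℤ) :=
    (((2 : ℕ) : ℤ) ^ i) • ((((2 : ℕ) : ℤ) ^ a) • cl 1) with hx₂
  -- `c_*` fixes the two order-`2` classes
  have hu₂fix : conjAct W c _ u₂ = (1 : ℤ) • u₂ := by
    rw [one_zsmul, hu₂, map_zsmul, map_zsmul, hsν, smul_comm (((2 : ℕ) : ℤ) ^ (M - a)) ν,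
      smul_comm (((2 : ℕ) : ℤ) ^ j) ν]
    exact hsignfix hν _ hu2
  have hx₂fix : conjAct W c _ x₂ = (1 : ℤ) • x₂ := by
    rw [one_zsmul, hx₂, map_zsmul, map_zsmul, hx1, smul_comm (((2 : ℕ) : ℤ) ^ a) ε,
      smul_comm (((2 : ℕ) : ℤ) ^ i) ε]
    exact hsignfix hε _ hxi2
  -- ### the target: a `τ`-moved point of order `2` in `E[2^M]`
  have hC := Literature.NumberTheory.Automorphic.chebotarev_artinRep_holds
  obtain ⟨c₀, hc₀⟩ := exists_isComplexConjugation (Rat.castHom ℝ)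
  have ht : IsLiftOfAut c (absGaloisTransport (K := ℚ) (L := K) c₀).toRingEquiv :=
    RatClosure.isLiftOfAut_absGaloisTransport_of_isImaginaryQuadratic hK hc hc₀
  obtain ⟨v₀, hv₀⟩ :=
    Summit.BirchSwinnertonDyer.BirchSwinnertonDyer.Theorems.KolyvaginEigenTwo.exists_twoTorsion_smul_ne_of_Δ_neg
      W hΔ hc₀
  set θ := RatClosure.torsionEquiv (K := K) W ((2 : ℕ) : ℤ) with hθ
  have hv : ht.torsionMap W ((2 : ℕ) : ℤ) (θ v₀) ≠ θ v₀ := by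
    rw [← RatClosure.torsionEquiv_smul_of_lift W ht c₀ (fun _ ↦ rfl) ((2 : ℕ) : ℤ) v₀]
    exact fun h ↦ hv₀ (θ.injective h)
  have hdvd : ((2 : ℕ) : ℤ) ∣ ((2 ^ M : ℕ) : ℤ) :=
    Int.natCast_dvd_natCast.mpr (dvd_pow_self 2 (Nat.one_le_iff_ne_zero.mp hM))
  set v₁ : geomTorsion (W.baseChange K) ((2 ^ M : ℕ) : ℤ) :=
    AddSubgroup.inclusion ((W.baseChange K).geomTorsion_le_of_dvd hdvd) (θ v₀) with hv₁
  have hv₁coe : (v₁ : geomPoints (W.baseChange K)) = (θ v₀ : geomPoints (W.baseChange K)) := rfl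
  have hv₁2 : ((2 : ℕ) : ℤ) • v₁ = 0 := by
    apply Subtype.ext
    rw [AddSubgroupClass.coe_zsmul, hv₁coe]
    exact (mem_geomTorsion_iff _ _ _).mp (θ v₀).2
  have hv₁τ : (1 : ℤ) • ht.torsionMap W ((2 ^ M : ℕ) : ℤ) v₁ + v₁ ≠ 0 := by
    rw [one_zsmul]
    intro h
    apply hv
    apply Subtype.ext
    have h2 : (2 : ℤ) • v₁ = 0 := by exact_mod_cast hv₁2
    rw [two_zsmul] at h2
    have h' : ht.torsionMap W ((2 ^ M : ℕ) : ℤ) v₁ = v₁ := by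
      rw [eq_neg_of_add_eq_zero_left h, neg_eq_of_add_eq_zero_left h2]
    have h'' := congrArg (fun R : geomTorsion (W.baseChange K) ((2 ^ M : ℕ) : ℤ) ↦
      (R : geomPoints (W.baseChange K))) h'
    simpa only [IsLiftOfAut.coe_torsionMap, hv₁coe] using h''
  -- ### Čebotarev at level `2^M`: a Kolyvagin prime `ℓ` of depth `M` with `u₂,λ ≠ 0`, `x₂,λ ≠ 0`
  obtain ⟨ℓ, hℓK, hfrobM, hux⟩ : ∃ ℓ : ℕ, IsKolyvaginPrime N W K 2 ℓ ∧ FrobEqFrobInfty W K (2 ^ M) ℓ ∧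
      ∀ v : HeightOneSpectrum (𝓞 K), (ℓ : 𝓞 K) ∈ v.asIdeal →
        u₂ ∉ (W.baseChange K).torsionLocalKer (v.adicCompletion K) ((2 ^ M : ℕ) : ℤ) ∧
          x₂ ∉ (W.baseChange K).torsionLocalKer (v.adicCompletion K) ((2 ^ M : ℕ) : ℤ) := by
    by_cases hux : u₂ = x₂
    · -- family `(x₂)`
      obtain ⟨ℓ, -, hℓ, hℓN, hℓD, hℓ2, hprime, hfrob, F, hF, hval, hloc⟩ :=
        KolyvaginImageTwo.exists_kolyvaginPrime_gt_two_pow_of_targets hC (N := N) W hK hρ hΔK hc hc₀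
          hM hzfix hcomm ![x₂] id (fun _ ↦ 1) (fun i ↦ by fin_cases i; exact hx₂fix) (fun _ ↦ 1)
          (fun i ↦ by fin_cases i; simpa using hxi2) (pow_one_dvd_of_sum_one hxi2 hxi0)
          (fun _ ↦ v₁) (fun _ ↦ by rw [pow_one]; exact hv₁2) 0
      refine ⟨ℓ, ⟨hℓ, hℓN, hℓD, hℓ2, hprime, FrobEqFrobInfty.of_dvd (dvd_pow_self 2
        (Nat.one_le_iff_ne_zero.mp hM)) hfrob⟩, hfrob, fun v hv ↦ ?_⟩
      have hx₂mem : x₂ ∈ AddSubgroup.closure (Set.range ![x₂]) :=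
        AddSubgroup.subset_closure ⟨0, rfl⟩
      have h0 := hval 0
      simp only [Matrix.cons_val_zero] at h0
      have h1 : x₂ ∉ (W.baseChange K).torsionLocalKer (v.adicCompletion K) ((2 ^ M : ℕ) : ℤ) := by
        rw [hloc x₂ hx₂mem v hv, h0]
        exact hv₁τ
      exact ⟨hux ▸ h1, h1⟩
    · -- family `(u₂, x₂)`
      obtain ⟨ℓ, -, hℓ, hℓN, hℓD, hℓ2, hprime, hfrob, F, hF, hval, hloc⟩ :=
        KolyvaginImageTwo.exists_kolyvaginPrime_gt_two_pow_of_targets hC (N := N) W hK hρ hΔK hc hc₀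
          hM hzfix hcomm ![u₂, x₂] id (fun _ ↦ 1)
          (fun i ↦ by fin_cases i; exacts [hu₂fix, hx₂fix]) (fun _ ↦ 1)
          (fun i ↦ by fin_cases i <;> simpa using (by first | exact hu2 | exact hxi2))
          (pow_one_dvd_of_sum_two hu2 hxi2 hu0 hxi0 hux)
          (fun _ ↦ v₁) (fun _ ↦ by rw [pow_one]; exact hv₁2) 0
      refine ⟨ℓ, ⟨hℓ, hℓN, hℓD, hℓ2, hprime, FrobEqFrobInfty.of_dvd (dvd_pow_self 2
        (Nat.one_le_iff_ne_zero.mp hM)) hfrob⟩, hfrob, fun v hv ↦ ?_⟩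
      have hu₂mem : u₂ ∈ AddSubgroup.closure (Set.range ![u₂, x₂]) :=
        AddSubgroup.subset_closure ⟨0, rfl⟩
      have hx₂mem : x₂ ∈ AddSubgroup.closure (Set.range ![u₂, x₂]) :=
        AddSubgroup.subset_closure ⟨1, rfl⟩
      have h0 := hval 0
      have h1 := hval 1
      simp only [Matrix.cons_val_zero, Matrix.cons_val_one] at h0 h1
      refine ⟨?_, ?_⟩
      · rw [hloc u₂ hu₂mem v hv, h0]; exact hv₁τ
      · rw [hloc x₂ hx₂mem v hv, h1]; exact hv₁τ
  have hℓprime : ℓ.Prime := hℓK.prime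
  -- ### Kolyvagin's class `d = c(ℓ)`: `ν`-eigen, Selmer off `ℓ` and at `∞`, `2^{i+a} d` NOT Selmer at `λ`
  have hkol : ∀ q' ∈ ℓ.primeFactors, IsKolyvaginPrime N W K 2 q' ∧ FrobEqFrobInfty W K (2 ^ M) q' := by
    intro q' hq'
    rw [hℓprime.primeFactors, Finset.mem_singleton] at hq'
    subst hq'
    exact ⟨hℓK, hfrobM⟩
  obtain ⟨h541, hdsel, hdloc⟩ := hrel ℓ hℓprime.squarefree hkol
  have hdeig : conjAct W c _ (cl ℓ) = (ε * (-1) ^ ℓ.primeFactors.card) • cl ℓ := by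
    rw [hcl ℓ]
    exact conjAct_kolyvaginClass_eq_smul W (hdiv := hdiv) hτ (hA ℓ) (hAτ ℓ) (hPt ℓ) _ h541
  have hcard1 : ε * (-1) ^ ℓ.primeFactors.card = ν := by
    rw [hℓprime.primeFactors, Finset.card_singleton, pow_one, hνε, mul_neg_one]
  rw [hcard1] at hdeig
  have hdsel' : ∀ v : HeightOneSpectrum (𝓞 K), (ℓ : 𝓞 K) ∉ v.asIdeal →
      cl ℓ ∈ selmerLocalKer (W.baseChange K) (v.adicCompletion K) ((2 ^ M : ℕ) : ℤ) := fun v hv ↦ by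
    rw [hcl ℓ]; exact hdsel v hv
  have hdloc' : (((2 : ℕ) : ℤ) ^ (i + a)) • cl ℓ ∈
        selmerLocalKer (W.baseChange K) (hℓK.place.adicCompletion K) ((2 ^ M : ℕ) : ℤ) ↔
      (((2 : ℕ) : ℤ) ^ (i + a)) • cl (ℓ / ℓ) ∈
        (W.baseChange K).torsionLocalKer (hℓK.place.adicCompletion K) ((2 ^ M : ℕ) : ℤ) := by
    have h := hdloc ℓ hℓprime dvd_rfl hℓK.place hℓK.mem_place (i + a)
    rw [← hcl ℓ, ← hcl (ℓ / ℓ)] at h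
    exact h
  rw [Nat.div_self hℓprime.pos] at hdloc'
  have hx₂eq : x₂ = (((2 : ℕ) : ℤ) ^ (i + a)) • cl 1 := by rw [hx₂, smul_smul, ← pow_add]
  have hdv : (((2 : ℕ) : ℤ) ^ (i + a)) • cl ℓ ∉
      selmerLocalKer (W.baseChange K) (hℓK.place.adicCompletion K) ((2 ^ M : ℕ) : ℤ) := fun hmem ↦
    (hux hℓK.place hℓK.mem_place).2 (hx₂eq ▸ hdloc'.mp hmem)
  have hdinf : ∀ w : InfinitePlace K,
      cl ℓ ∈ selmerLocalKer (W.baseChange K) w.Completion ((2 ^ M : ℕ) : ℤ) := fun w ↦ by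
    haveI : IsAlgClosed w.Completion := isAlgClosed_of_ringEquiv
      (InfinitePlace.Completion.ringEquivComplexOfIsComplex (IsTotallyComplex.isComplex w)).symm
    rw [WeierstrassCurve.selmerLocalKer_eq_top_of_isAlgClosed]
    trivial
  have hgood : (W.baseChange K).HasGoodReductionAt hℓK.place := by
    have h := IsKolyvaginPrime.not_mem_badPlaces (W := W) hP hℓK
    rwa [WeierstrassCurve.mem_badPlaces_iff, not_not] at h
  -- ### leaf (B) at `2^M` (exponent `i + a`): `2^{M-i-a-1}·(s + ν c_* s) ∈ ker loc_λ`
  obtain ⟨B, _, e, halt, hnd, hRe⟩ := hRT hℓK hfrobM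
  have hfin := lemma_5_3_descent_two_pow W hK hc hΔ hℓK hM (q := 2 ^ M) rfl hfrobM hgood e halt hnd
    hν hdeig hdv hs
    (fun 𝔔 h𝔔 F hF hFT σ hσ ↦ hRe ∅ s hs (fun _ h ↦ absurd h (Finset.notMem_empty _)) (cl ℓ)
      (fun v _ hv ↦ hdsel' v hv) hdinf 𝔔 h𝔔 F hF hFT σ hσ)
  -- `s + ν c_* s = s + s`
  rw [hsν, smul_smul, hνν, one_smul] at hfin
  -- ### `u₂ = 2^{j+i} · 2^{M-i-a-1}(s + s)` is then locally trivial at `λ`: contradiction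
  have hkey : u₂ = (((2 : ℕ) : ℤ) ^ (j + i)) • ((((2 : ℕ) : ℤ) ^ (M - (i + a) - 1)) • (s + s)) := by
    rw [hu₂, smul_smul, smul_smul, ← two_zsmul, smul_smul]
    congr 1
    rw [show (2 : ℤ) = ((2 : ℕ) : ℤ) by norm_num, mul_assoc, ← pow_succ, ← pow_add, ← pow_add]
    congr 1
    omega
  apply (hux hℓK.place hℓK.mem_place).1
  rw [hkey]
  exact AddSubgroup.zsmul_mem _ hfin _

/-- **The same with the machine's inputs as ty2's DATA (`P2.KolyvaginMachine`, p601266), full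
support, used at level `M`**: a point-system family and a reciprocity family at `p = 2` give
`2^{M−a}·Sel_{2^M}(E/K)^{ν} = 0` (`ν = −ε`) when `2^a y_K ∉ 2^M E(K)` (`ρ̄_{E,2}` onto, `Δ_E < 0`,
`Δ_E ∉ K²`, the Cartan-type `z`). [cite: GrossLMS1991, Prop. 2.1 with §10 (proof)]
[cite: McCallumLMS1991, §2 Prop. 2.2, §5 Lemmas 5.1, 5.3] -/
theorem two_pow_smul_selmer_minus_eq_zero_of_families_two_pow {N : ℕ} [NeZero N] [W.IsElliptic]
    (hK : IsImaginaryQuadratic K) {P : (W.baseChange K).toAffine.Point} (hP : IsHeegnerPoint N W K P)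
    (hρ : W.HasSurjectiveModNGaloisRep 2) (hΔ : W.Δ < 0) (hΔK : ¬ IsSquare (W.baseChange K).Δ)
    {c : K ≃ₐ[ℚ] K} (hc : c ≠ 1) {M : ℕ} (hM : 1 ≤ M) {z : absoluteGaloisGroup K}
    (hzfix : ∀ T : geomTorsion (W.baseChange K) ((2 : ℕ) : ℤ), z • T = T → T = 0)
    (hcomm : ∀ π ∈ torsionFixing (W.baseChange K) ((2 : ℕ) : ℤ),
      ∀ T : geomTorsion (W.baseChange K) ((2 ^ M : ℕ) : ℤ), π • z • T = z • π • T)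
    {a : ℕ} (ha : a < M)
    (hy : ∀ Q : (W.baseChange K).toAffine.Point, ((2 ^ M : ℕ) : ℤ) • Q ≠ ((((2 : ℕ) : ℤ) ^ a)) • P)
    {ν : ℤ} (hν : ν = 1 ∨ ν = -1)
    (hPν : ¬ IsOfFinAddOrder (Affine.Point.map (W' := W) (c : K →ₐ[ℚ] K) P - ν • P))
    (D : Rank1Residual.P2.KolyvaginMachine.PointSystemFamily N W K P 2 fun _ ↦ True)
    (R : Rank1Residual.P2.KolyvaginMachine.ReciprocityFamily N W K 2 fun _ ↦ True) :
    ∀ s ∈ selmerGroup (W.baseChange K) ((2 ^ M : ℕ) : ℤ), conjAct W c ((2 ^ M : ℕ) : ℤ) s = ν • s →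
      (((2 : ℕ) : ℤ) ^ (M - a)) • s = 0 := by
  refine two_pow_smul_selmer_minus_eq_zero_two_pow W hK hP hρ hΔ hΔK hc hM (q := 2 ^ M) rfl hzfix
    hcomm ha hy hν hPν ?_ ?_
  · intro hdiv
    obtain ⟨ε, τ, hτ, A, hA, Pt, hPt, hε, h53, hAτ, hPt1, hm'⟩ :=
      Rank1Residual.P2.KolyvaginMachine.hpoints_of_pointSystemFamily D hM hdiv c hc
    exact ⟨ε, τ, hτ, A, hA, Pt, hPt, hε, h53, hAτ, hPt1, fun m hm hq ↦
      hm' m hm fun q hq' ↦ ⟨(hq q hq').1, (hq q hq').2, trivial⟩⟩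
  · intro ℓ hℓ hF
    exact Rank1Residual.P2.KolyvaginMachine.hRT_of_reciprocityFamily R hM hℓ hF trivial

end Summit.BirchSwinnertonDyer.BirchSwinnertonDyer.Theorems.KolyvaginDescentTwo

end
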